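import Summits.Ventures.CertifiedArithmetic.LowPrec.SignificandError
import Summits.Ventures.CertifiedArithmetic.LowPrec.DirectedMirror

/-!
# Significand-level error formulas, value level (THEOREMS-R1, Theorem E5, closed form — part 2)

HONEST FRAMING (venture CertifiedArithmetic / cell `pub-lowprec`): certified error envelopes and
provably optimal rounding/accumulation schemes for low-precision formats under stated cost models;
every table by two implementations; no hardware or vendor claims.

The analytic half of Theorem E5 of `THEOREMS-R1.md` (sec. 3) for the four roundings of the
enumeration tables and EVERY format `φ` (precision `P = m + 1`): if an exact result has magnitude
`|x| = n · 2^s / 2^k · quantum ≤ maxRat` with a `P+k`-bit pattern `n` (`2^(m+k) ≤ n < 2^(m+k+1)`),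
then `|x|` lies in the normal binade of spacing `2^s · quantum` (`MiniFloat.shift_of_pattern`) and,
with `rem = n mod 2^k`, the rounding error is `err · 2^s / 2^k · quantum`, i.e. `err / 2^k` ulps and
`err / n` relative to `|x|`, where
* `err = min(rem, 2^k - rem)` to nearest (`MiniFloat.abs_sub_roundNE_of_pattern`,
  `relErr_roundNE_of_pattern`, `ulpErr_roundNE_of_pattern`);
* `err = rem` toward zero (`abs_sub_roundTowardZero_of_pattern`, `relErr_/ulpErr_roundTowardZero_…`)
  and on the toward-zero sides of the directed modes (`sub_roundDown_of_pattern` for `x ≥ 0`,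
  `roundUp_sub_of_pattern_neg` for `x < 0`);
* `err = 2^k - rem`, or `0` when `rem = 0`, on the away sides (`sub_roundDown_of_pattern_neg`,
  `roundUp_sub_of_pattern`).
Hence the error relative to `|x|` or in ulps is a function of the pattern `(n, k)` ALONE and not of
the binade `s` (`relErr_roundNE_eq_of_pattern`, `relErr_roundTowardZero_eq_of_pattern`: the clause
"depends on n alone" of Theorem E5, sharper than the doubling statement `fl(2^j x) = 2^j fl(x)` of
`ScaleInvariance.lean` because two values with the same pattern need not differ by a power of two
in range), with no exception in the top binade, and the result is exact iff `2^k ∣ n`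
(`toRat_roundNE_eq_self_iff_of_pattern`, `toRat_roundTowardZero_eq_self_iff_of_pattern`). The
grid-level formulas are `SignificandError.lean`. NOT formalised here: the bookkeeping half of
Theorem E5 (which patterns are REALISABLE as `a·b` / `a·2^g ± b` from two operand formats and
PLACEABLE in the normal range of the destination); per table that maximum is kernel-checked by
enumeration (`Envelopes*.lean`, `EnvelopesDirected*.lean`), and the enumerator over patterns is
`code/enum/envconst.py` (pre-registered constants `certs/enum/PREDICTIONS-ENVCONST*.json`).

Placement: venture development under `Summits/Ventures/CertifiedArithmetic/`; declarations are
dot-notation extensions of the Literature structure `MiniFloat` and carry their absolute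
`Literature.ComputerArithmetic.FloatingPoint.…` names (CONVENTIONS §2). New work of the venture
(elementary; [folklore] tags mark statements any numerical analyst would recognise, cf.
[cite: Higham2002ASNA, §2.1]; Knuth, TAOCP vol. 2, §4.2.2).
-/

namespace Literature.ComputerArithmetic.FloatingPoint

/-! ### Value level: the four roundings of `x` with `|x| = n · 2^s / 2^k · quantum` -/

namespace MiniFloat

open Format

variable {φ : Format}

/-- The scaled magnitude of a value with pattern data `(n, k, s)`. [folklore] -/
theorem scaledInput_of_pattern {x : ℚ} {n k s : ℕ}
    (hx : |x| = (n : ℚ) * 2 ^ s / 2 ^ k * φ.quantum) :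
    |x| / φ.quantum = (n : ℚ) * 2 ^ s / 2 ^ k := by
  rw [hx, mul_div_cancel_right₀ _ (ne_of_gt φ.quantum_pos)]

/-- In range in quanta: `|x| ≤ maxRat` gives `n · 2^s / 2^k ≤ maxScaled`. [folklore] -/
theorem pattern_le_maxScaled {x : ℚ} {n k s : ℕ}
    (hx : |x| = (n : ℚ) * 2 ^ s / 2 ^ k * φ.quantum) (hmax : |x| ≤ φ.maxRat) :
    (n : ℚ) * 2 ^ s / 2 ^ k ≤ φ.maxScaled := by
  rw [hx] at hmax
  unfold Format.maxRat at hmax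
  exact le_of_mul_le_mul_right hmax φ.quantum_pos

/-- PATTERN BINADE (values): `|x| = n · 2^s / 2^k · quantum ≤ maxRat` with a `P+k`-bit pattern `n`
lies in the binade of spacing `2^s · quantum` (the ulp of `DirectedEnvelope.lean`). [folklore] -/
theorem shift_of_pattern {x : ℚ} {n k s : ℕ} (hlo : 2 ^ (φ.manBits + k) ≤ n)
    (hhi : n < 2 ^ (φ.manBits + k + 1)) (hx : |x| = (n : ℚ) * 2 ^ s / 2 ^ k * φ.quantum)
    (hmax : |x| ≤ φ.maxRat) : φ.shift ⌊|x| / φ.quantum⌋.toNat = s := by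
  rw [scaledInput_of_pattern hx]
  exact Format.shift_floor_of_pattern hlo hhi (pattern_le_maxScaled hx hmax)

/-- NEAREST, SIGNIFICAND LEVEL: `|x - RNE x| = min(rem, 2^k - rem) · 2^s / 2^k · quantum` for
`|x| = n · 2^s / 2^k · quantum ≤ maxRat`, `n` a `P+k`-bit pattern, `rem = n mod 2^k` — every
format, every normal binade, the top one included. [folklore] -/
theorem abs_sub_roundNE_of_pattern {x : ℚ} {n k s : ℕ} (hlo : 2 ^ (φ.manBits + k) ≤ n)
    (hhi : n < 2 ^ (φ.manBits + k + 1)) (hx : |x| = (n : ℚ) * 2 ^ s / 2 ^ k * φ.quantum)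
    (hmax : |x| ≤ φ.maxRat) :
    |x - (roundNE φ x).toRat|
      = ((min (n % 2 ^ k) (2 ^ k - n % 2 ^ k) : ℕ) : ℚ) * 2 ^ s / 2 ^ k * φ.quantum := by
  rw [abs_sub_roundNE, scaledInput_of_pattern hx,
    Format.abs_sub_rneGrid_of_pattern hlo hhi (pattern_le_maxScaled hx hmax)]

/-- The toward-zero error in closed form: `|x - RZ x| = (r - rdGrid r) · quantum`, `r = |x| / quantum`.
[folklore] -/
theorem abs_sub_roundTowardZero (x : ℚ) : |x - (roundTowardZero φ x).toRat|
    = (|x| / φ.quantum - φ.rdGrid (|x| / φ.quantum)) * φ.quantum := by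
  have hq := φ.quantum_pos
  rw [toRat_roundTowardZero]
  by_cases hx : x < 0
  · rw [if_pos hx, abs_of_neg hx, abs_of_nonpos]
    · field_simp; ring
    · have := Format.rdGrid_le (φ := φ) (r := -x / φ.quantum) (div_nonneg (by linarith) hq.le)
      rw [le_div_iff₀ hq] at this
      linarith
  · rw [if_neg hx, abs_of_nonneg (not_lt.mp hx), abs_of_nonneg]
    · field_simp
    · have := Format.rdGrid_le (φ := φ) (r := x / φ.quantum) (div_nonneg (not_lt.mp hx) hq.le)
      rw [le_div_iff₀ hq] at this
      linarith

/-- TOWARD ZERO, SIGNIFICAND LEVEL: `|x - RZ x| = rem · 2^s / 2^k · quantum`. [folklore] -/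
theorem abs_sub_roundTowardZero_of_pattern {x : ℚ} {n k s : ℕ} (hlo : 2 ^ (φ.manBits + k) ≤ n)
    (hhi : n < 2 ^ (φ.manBits + k + 1)) (hx : |x| = (n : ℚ) * 2 ^ s / 2 ^ k * φ.quantum)
    (hmax : |x| ≤ φ.maxRat) :
    |x - (roundTowardZero φ x).toRat| = ((n % 2 ^ k : ℕ) : ℚ) * 2 ^ s / 2 ^ k * φ.quantum := by
  rw [abs_sub_roundTowardZero, scaledInput_of_pattern hx,
    Format.sub_rdGrid_of_pattern hlo hhi (pattern_le_maxScaled hx hmax)]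

/-- The round-down error in closed form: `x - RD x = (r - rdGrid r) · quantum` for `x ≥ 0` and
`(ruGrid r - r) · quantum` for `x < 0` (`r = |x| / quantum`). [folklore] -/
theorem sub_roundDown_eq (x : ℚ) : x - (roundDown φ x).toRat
    = (if x < 0 then (φ.ruGrid (|x| / φ.quantum) : ℚ) - |x| / φ.quantum
        else |x| / φ.quantum - φ.rdGrid (|x| / φ.quantum)) * φ.quantum := by
  have hq := φ.quantum_pos
  rw [toRat_roundDown]
  split_ifs with hx
  · rw [abs_of_neg hx]; field_simp; ring
  · rw [abs_of_nonneg (not_lt.mp hx)]; field_simp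

/-- ROUND DOWN, `x ≥ 0` (the toward-zero side): `x - RD x = rem · 2^s / 2^k · quantum`. [folklore] -/
theorem sub_roundDown_of_pattern {x : ℚ} {n k s : ℕ} (hx0 : 0 ≤ x) (hlo : 2 ^ (φ.manBits + k) ≤ n)
    (hhi : n < 2 ^ (φ.manBits + k + 1)) (hx : |x| = (n : ℚ) * 2 ^ s / 2 ^ k * φ.quantum)
    (hmax : |x| ≤ φ.maxRat) :
    x - (roundDown φ x).toRat = ((n % 2 ^ k : ℕ) : ℚ) * 2 ^ s / 2 ^ k * φ.quantum := by
  rw [sub_roundDown_eq, if_neg (not_lt.mpr hx0), scaledInput_of_pattern hx,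
    Format.sub_rdGrid_of_pattern hlo hhi (pattern_le_maxScaled hx hmax)]

/-- ROUND DOWN, `x < 0` (the away side): `x - RD x = (2^k - rem) · 2^s / 2^k · quantum`, or `0` when
`rem = 0`. [folklore] -/
theorem sub_roundDown_of_pattern_neg {x : ℚ} {n k s : ℕ} (hx0 : x < 0)
    (hlo : 2 ^ (φ.manBits + k) ≤ n) (hhi : n < 2 ^ (φ.manBits + k + 1))
    (hx : |x| = (n : ℚ) * 2 ^ s / 2 ^ k * φ.quantum) (hmax : |x| ≤ φ.maxRat) :
    x - (roundDown φ x).toRat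
      = ((if n % 2 ^ k = 0 then 0 else 2 ^ k - n % 2 ^ k : ℕ) : ℚ) * 2 ^ s / 2 ^ k * φ.quantum := by
  rw [sub_roundDown_eq, if_pos hx0, scaledInput_of_pattern hx,
    Format.ruGrid_sub_of_pattern hlo hhi (pattern_le_maxScaled hx hmax)]

/-- ROUND UP, `x > 0` (the away side): `RU x - x = (2^k - rem) · 2^s / 2^k · quantum`, or `0` when
`rem = 0` — by the mirror `RU x = -RD(-x)`. [folklore] -/
theorem roundUp_sub_of_pattern {x : ℚ} {n k s : ℕ} (hx0 : 0 < x) (hlo : 2 ^ (φ.manBits + k) ≤ n)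
    (hhi : n < 2 ^ (φ.manBits + k + 1)) (hx : |x| = (n : ℚ) * 2 ^ s / 2 ^ k * φ.quantum)
    (hmax : |x| ≤ φ.maxRat) :
    (roundUp φ x).toRat - x
      = ((if n % 2 ^ k = 0 then 0 else 2 ^ k - n % 2 ^ k : ℕ) : ℚ) * 2 ^ s / 2 ^ k * φ.quantum := by
  have h := sub_roundDown_of_pattern_neg (φ := φ) (x := -x) (neg_lt_zero.mpr hx0) hlo hhi
    (by rwa [abs_neg]) (by rwa [abs_neg])
  rw [toRat_roundDown_neg] at h
  linarith

/-- ROUND UP, `x < 0` (the toward-zero side): `RU x - x = rem · 2^s / 2^k · quantum`. [folklore] -/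
theorem roundUp_sub_of_pattern_neg {x : ℚ} {n k s : ℕ} (hx0 : x < 0)
    (hlo : 2 ^ (φ.manBits + k) ≤ n) (hhi : n < 2 ^ (φ.manBits + k + 1))
    (hx : |x| = (n : ℚ) * 2 ^ s / 2 ^ k * φ.quantum) (hmax : |x| ≤ φ.maxRat) :
    (roundUp φ x).toRat - x = ((n % 2 ^ k : ℕ) : ℚ) * 2 ^ s / 2 ^ k * φ.quantum := by
  have h := sub_roundDown_of_pattern (φ := φ) (x := -x) (by linarith) hlo hhi
    (by rwa [abs_neg]) (by rwa [abs_neg])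
  rw [toRat_roundDown_neg] at h
  linarith

/-! ### Theorem E5: relative and ulp errors depend on the pattern alone -/

/-- From an absolute pattern error to the relative one: `(E · 2^s/2^k · q) / (n · 2^s/2^k · q) =
E / n`. [folklore] -/
theorem pattern_err_div_pattern (E : ℕ) {n : ℕ} (hn : 0 < n) (k s : ℕ) {q : ℚ} (hq : 0 < q) :
    ((E : ℚ) * 2 ^ s / 2 ^ k * q) / ((n : ℚ) * 2 ^ s / 2 ^ k * q) = (E : ℚ) / n := by
  have hn' : (n : ℚ) ≠ 0 := by exact_mod_cast hn.ne'
  have hq' : q ≠ 0 := ne_of_gt hq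
  field_simp

/-- From an absolute pattern error to the error in ulps: `(E · 2^s/2^k · q) / (2^s · q) = E / 2^k`.
[folklore] -/
theorem pattern_err_div_ulp (E k s : ℕ) {q : ℚ} (hq : 0 < q) :
    ((E : ℚ) * 2 ^ s / 2 ^ k * q) / (2 ^ s * q) = (E : ℚ) / 2 ^ k := by
  have hq' : q ≠ 0 := ne_of_gt hq
  field_simp

/-- THEOREM E5, NEAREST: the relative error of `RNE` at `|x| = n · 2^s / 2^k · quantum ≤ maxRat` is
`min(rem, 2^k - rem) / n` — a function of the pattern `(n, k)`, not of the binade `s`. [folklore] -/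
theorem relErr_roundNE_of_pattern {x : ℚ} {n k s : ℕ} (hlo : 2 ^ (φ.manBits + k) ≤ n)
    (hhi : n < 2 ^ (φ.manBits + k + 1)) (hx : |x| = (n : ℚ) * 2 ^ s / 2 ^ k * φ.quantum)
    (hmax : |x| ≤ φ.maxRat) :
    |x - (roundNE φ x).toRat| / |x| = ((min (n % 2 ^ k) (2 ^ k - n % 2 ^ k) : ℕ) : ℚ) / n := by
  have hn : 0 < n := lt_of_lt_of_le (Nat.two_pow_pos _) hlo
  rw [abs_sub_roundNE_of_pattern hlo hhi hx hmax, hx]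
  exact pattern_err_div_pattern _ hn k s φ.quantum_pos

/-- THEOREM E5, NEAREST, IN ULPS: `|x - RNE x| / (2^s · quantum) = min(rem, 2^k - rem) / 2^k`.
[folklore] -/
theorem ulpErr_roundNE_of_pattern {x : ℚ} {n k s : ℕ} (hlo : 2 ^ (φ.manBits + k) ≤ n)
    (hhi : n < 2 ^ (φ.manBits + k + 1)) (hx : |x| = (n : ℚ) * 2 ^ s / 2 ^ k * φ.quantum)
    (hmax : |x| ≤ φ.maxRat) :
    |x - (roundNE φ x).toRat| / (2 ^ s * φ.quantum)
      = ((min (n % 2 ^ k) (2 ^ k - n % 2 ^ k) : ℕ) : ℚ) / 2 ^ k := by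
  rw [abs_sub_roundNE_of_pattern hlo hhi hx hmax]
  exact pattern_err_div_ulp _ k s φ.quantum_pos

/-- THEOREM E5, TOWARD ZERO: the relative error of `RZ` is `rem / n`. [folklore] -/
theorem relErr_roundTowardZero_of_pattern {x : ℚ} {n k s : ℕ} (hlo : 2 ^ (φ.manBits + k) ≤ n)
    (hhi : n < 2 ^ (φ.manBits + k + 1)) (hx : |x| = (n : ℚ) * 2 ^ s / 2 ^ k * φ.quantum)
    (hmax : |x| ≤ φ.maxRat) :
    |x - (roundTowardZero φ x).toRat| / |x| = ((n % 2 ^ k : ℕ) : ℚ) / n := by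
  have hn : 0 < n := lt_of_lt_of_le (Nat.two_pow_pos _) hlo
  rw [abs_sub_roundTowardZero_of_pattern hlo hhi hx hmax, hx]
  exact pattern_err_div_pattern _ hn k s φ.quantum_pos

/-- THEOREM E5, TOWARD ZERO, IN ULPS: `|x - RZ x| / (2^s · quantum) = rem / 2^k`. [folklore] -/
theorem ulpErr_roundTowardZero_of_pattern {x : ℚ} {n k s : ℕ} (hlo : 2 ^ (φ.manBits + k) ≤ n)
    (hhi : n < 2 ^ (φ.manBits + k + 1)) (hx : |x| = (n : ℚ) * 2 ^ s / 2 ^ k * φ.quantum)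
    (hmax : |x| ≤ φ.maxRat) :
    |x - (roundTowardZero φ x).toRat| / (2 ^ s * φ.quantum) = ((n % 2 ^ k : ℕ) : ℚ) / 2 ^ k := by
  rw [abs_sub_roundTowardZero_of_pattern hlo hhi hx hmax]
  exact pattern_err_div_ulp _ k s φ.quantum_pos

/-- BINADE-FREE (Theorem E5, first clause): two in-range values with the same pattern `(n, k)` in
any two normal binades `s, s'` have the same relative `RNE` error. [folklore] -/
theorem relErr_roundNE_eq_of_pattern {x x' : ℚ} {n k s s' : ℕ} (hlo : 2 ^ (φ.manBits + k) ≤ n)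
    (hhi : n < 2 ^ (φ.manBits + k + 1)) (hx : |x| = (n : ℚ) * 2 ^ s / 2 ^ k * φ.quantum)
    (hx' : |x'| = (n : ℚ) * 2 ^ s' / 2 ^ k * φ.quantum) (hmax : |x| ≤ φ.maxRat)
    (hmax' : |x'| ≤ φ.maxRat) :
    |x - (roundNE φ x).toRat| / |x| = |x' - (roundNE φ x').toRat| / |x'| := by
  rw [relErr_roundNE_of_pattern hlo hhi hx hmax, relErr_roundNE_of_pattern hlo hhi hx' hmax']

/-- BINADE-FREE, toward zero: same pattern, same relative `RZ` error. [folklore] -/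
theorem relErr_roundTowardZero_eq_of_pattern {x x' : ℚ} {n k s s' : ℕ}
    (hlo : 2 ^ (φ.manBits + k) ≤ n) (hhi : n < 2 ^ (φ.manBits + k + 1))
    (hx : |x| = (n : ℚ) * 2 ^ s / 2 ^ k * φ.quantum)
    (hx' : |x'| = (n : ℚ) * 2 ^ s' / 2 ^ k * φ.quantum) (hmax : |x| ≤ φ.maxRat)
    (hmax' : |x'| ≤ φ.maxRat) :
    |x - (roundTowardZero φ x).toRat| / |x| = |x' - (roundTowardZero φ x').toRat| / |x'| := by
  rw [relErr_roundTowardZero_of_pattern hlo hhi hx hmax,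
    relErr_roundTowardZero_of_pattern hlo hhi hx' hmax']

/-- EXACTNESS BY PATTERN: `RNE x = x` iff `2^k ∣ n`, i.e. iff the pattern has at most `P`
significant bits after removing trailing zeros. [folklore] -/
theorem toRat_roundNE_eq_self_iff_of_pattern {x : ℚ} {n k s : ℕ} (hlo : 2 ^ (φ.manBits + k) ≤ n)
    (hhi : n < 2 ^ (φ.manBits + k + 1)) (hx : |x| = (n : ℚ) * 2 ^ s / 2 ^ k * φ.quantum)
    (hmax : |x| ≤ φ.maxRat) : (roundNE φ x).toRat = x ↔ 2 ^ k ∣ n := by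
  have hpos : (0 : ℚ) < 2 ^ s / 2 ^ k * φ.quantum := by have := φ.quantum_pos; positivity
  rw [eq_comm, ← sub_eq_zero, ← abs_eq_zero, abs_sub_roundNE_of_pattern hlo hhi hx hmax,
    show ((min (n % 2 ^ k) (2 ^ k - n % 2 ^ k) : ℕ) : ℚ) * 2 ^ s / 2 ^ k * φ.quantum
      = ((min (n % 2 ^ k) (2 ^ k - n % 2 ^ k) : ℕ) : ℚ) * (2 ^ s / 2 ^ k * φ.quantum) by ring,
    mul_eq_zero, or_iff_left (ne_of_gt hpos), Nat.cast_eq_zero, min_mod_two_pow_eq_zero_iff]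

/-- EXACTNESS BY PATTERN, toward zero: `RZ x = x` iff `2^k ∣ n`. [folklore] -/
theorem toRat_roundTowardZero_eq_self_iff_of_pattern {x : ℚ} {n k s : ℕ}
    (hlo : 2 ^ (φ.manBits + k) ≤ n) (hhi : n < 2 ^ (φ.manBits + k + 1))
    (hx : |x| = (n : ℚ) * 2 ^ s / 2 ^ k * φ.quantum) (hmax : |x| ≤ φ.maxRat) :
    (roundTowardZero φ x).toRat = x ↔ 2 ^ k ∣ n := by
  have hρ : n % 2 ^ k < 2 ^ k := Nat.mod_lt n (Nat.two_pow_pos k)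
  have hpos : (0 : ℚ) < 2 ^ s / 2 ^ k * φ.quantum := by have := φ.quantum_pos; positivity
  rw [eq_comm, ← sub_eq_zero, ← abs_eq_zero, abs_sub_roundTowardZero_of_pattern hlo hhi hx hmax,
    show ((n % 2 ^ k : ℕ) : ℚ) * 2 ^ s / 2 ^ k * φ.quantum
      = ((n % 2 ^ k : ℕ) : ℚ) * (2 ^ s / 2 ^ k * φ.quantum) by ring,
    mul_eq_zero, or_iff_left (ne_of_gt hpos), Nat.cast_eq_zero]
  exact ⟨fun h => Nat.dvd_of_mod_eq_zero h, fun h => Nat.mod_eq_zero_of_dvd h⟩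

end MiniFloat

end Literature.ComputerArithmetic.FloatingPoint
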